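import Literature.NumberTheory.Sieve.FriedlanderIwaniecPrimesMainTermSplit
import Literature.NumberTheory.Sieve.FriedlanderIwaniecPrimesLogSineSeparation
import HarnessLib

/-!
# Friedlander–Iwaniec, *The polynomial `X² + Y⁴` captures its primes*: the logarithm of the main-term kernel (10.13)
# as the angle function of §§15–16 ((7.2), (15.4), (16.7)) — tree vocabulary

Source: J. Friedlander, H. Iwaniec, Ann. of Math. (2) 148 (1998), 945–1040 [FriedlanderIwaniecAnnals1998]
(= arXiv:math/9811185), (7.2) p. 25, (10.13) p. 34, (15.4) p. 58, (16.6)–(16.7) p. 59.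

The tree's main term `T(β) = U + V + W` (`…MainTermSplit`: `fiTwisted`, kernel
`fiTKernel d z₁ z₂ = φ(d)/d · χ_d(z₂/z₁) · log(2|z₁z₂|/|Δ|)` with `fiAbsProd z₁ z₂ = (|z₁|²|z₂|²)^{1/2}` and
`fiDelta z₁ z₂ = Im(z̄₁z₂) ∈ ℤ`) carries the logarithm `log 2|z₁z₂/Δ|`, while §15 and §16 treat it as the
function `-log ½|sin(α₂ - α₁)|` of the angle difference ((15.4), via (7.2) `Δ = |z₁z₂| sin(α₂ - α₁)`) and
replace it by the mollified `u(α₂ - α₁)` ((15.5), (16.6)–(16.7)), whose Fourier analysis is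
`…LogSineMollifier` / `…LogSineSeparation` (functions `fiLogSin`, `logSineMollifier H`).  This file is the
dictionary between the two vocabularies (Gaussian integers `z : ℤ[i]`, `gaussArg z = arg z` of
`…GaussianSector`), all PROVED:

* `fiAbsProd_eq_norm_mul` (`|z₁z₂| = |z₁| |z₂|` in `ℂ`), `fiDelta_cast` (`Δ = Im(z̄₁ z₂)` in `ℂ`),
  `fiDelta_eq_fiAbsProd_mul_sin` (**(7.2)**: `Δ(z₁,z₂) = |z₁z₂| sin(arg z₂ - arg z₁)`), `abs_fiDelta_le_fiAbsProd`;
* `log_fiAbsProd_div_fiDelta` (**(15.4)/(16.7)**: `log(2|z₁z₂|/|Δ|) = L(arg z₂ - arg z₁)`, `L = log 2 - log|sin|`,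
  for `Δ ≠ 0`), its mirror `log_fiAbsProd_div_fiDelta'` (`L` is even), `fiTKernel_eq_fiLogSin` (the kernel of
  (10.13) through `L`), and the trivial size `log 2 ≤ log(2|z₁z₂|/|Δ|) ≤ log(2|z₁z₂|)`
  (`log_two_le_log_kernel`, `log_kernel_le`);
* the mollified kernel: `logSineMollifier_gaussArg_sub_eq` (`u_H(arg z₂ - arg z₁) = log(2|z₁z₂|/|Δ|)` as soon as
  `|z₁z₂| ≤ H|Δ|` — "the mollifier does not alter the value (15.4)" off the diagonal) and, for the near-diagonal
  terms that (16.6) removes "by a trivial estimation", `fiLogSin_sub_logSineMollifier_mem_Icc`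
  (`0 ≤ L - u_H ≤ L` pointwise) — so the cost of mollifying any finite sum with kernel `L` is at most the
  same sum restricted to the pairs with `|z₁z₂| > H|Δ|`, with `|L| ≤ log(2|z₁z₂|)` there
  (`abs_log_kernel_sub_mollifier_le`).

No definitions, no named facts, no `sorry`.

## References
* J. Friedlander, H. Iwaniec, Ann. of Math. (2) 148 (1998), 945–1040, (7.2), (10.13), (15.4)–(15.5),
  (16.6)–(16.7). [FriedlanderIwaniecAnnals1998]

## Tree / Mathlib
Tree: `fiDelta`, `fiAbsProd`, `fiTKernel`, `fiChi` (`…MainTermSplit`), `gaussArg` (`…GaussianSector`),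
`im_star_mul` (`…CharacterDetection`), `conj_mul_im` (`…QuarticForm`), `fiLogSin`, `logSineMollifier`,
`log_two_le_fiLogSin`, `logSineCutoff_mem_Icc` (`…LogSineMollifier`), `log_two_mul_norm_div_abs_im`,
`logSineMollifier_arg_sub_eq`, `fiLogSin_neg` (`…LogSineSeparation`). Mathlib: `GaussianInt.intCast_real_norm`,
`GaussianInt.intCast_im`, `GaussianInt.toComplex_star`, `Complex.normSq_eq_norm_sq`.
-/

noncomputable section

open Real Complex
open scoped ComplexConjugate

namespace Literature.NumberTheory.Sieve.FriedlanderIwaniecPrimes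

/-! ### The pair invariants `|z₁z₂|`, `Δ(z₁,z₂)` through `ℂ` -/

/-- `|z₁z₂| = |z₁|·|z₂|` (complex absolute values). [cite: FriedlanderIwaniecAnnals1998, (7.2) (`|z₁z₂|`)] -/
theorem fiAbsProd_eq_norm_mul (z₁ z₂ : GaussianInt) :
    fiAbsProd z₁ z₂ = ‖GaussianInt.toComplex z₁‖ * ‖GaussianInt.toComplex z₂‖ := by
  unfold fiAbsProd
  rw [GaussianInt.intCast_real_norm, GaussianInt.intCast_real_norm, Complex.normSq_eq_norm_sq,
    Complex.normSq_eq_norm_sq, ← mul_pow, Real.sqrt_sq (by positivity)]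

/-- `0 ≤ |z₁z₂|`. [folklore] -/
private theorem lsk_fiAbsProd_nonneg (z₁ z₂ : GaussianInt) : 0 ≤ fiAbsProd z₁ z₂ := by
  rw [fiAbsProd_eq_norm_mul]; positivity

/-- `Δ(z₁,z₂) = Im(z̄₁z₂)`, computed in `ℂ`. [cite: FriedlanderIwaniecAnnals1998, (6.1) and (7.2)] -/
theorem fiDelta_cast (z₁ z₂ : GaussianInt) :
    ((fiDelta z₁ z₂ : ℤ) : ℝ) = (conj (GaussianInt.toComplex z₁) * GaussianInt.toComplex z₂).im := by
  rw [fiDelta, GaussianInt.intCast_im, map_mul, GaussianInt.toComplex_star]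

/-- **(7.2)**: `Δ(z₁,z₂) = |z₁z₂| sin(α₂ - α₁)`, `α_j = arg z_j`. [cite: FriedlanderIwaniecAnnals1998, (7.2)] -/
theorem fiDelta_eq_fiAbsProd_mul_sin (z₁ z₂ : GaussianInt) :
    ((fiDelta z₁ z₂ : ℤ) : ℝ) = fiAbsProd z₁ z₂ * Real.sin (gaussArg z₂ - gaussArg z₁) := by
  rw [fiDelta_cast, conj_mul_im, fiAbsProd_eq_norm_mul, gaussArg, gaussArg]

/-- `|Δ(z₁,z₂)| ≤ |z₁z₂|` ("`1 ≤ |Δ| ≤ N`" uses this with the box). [cite: FriedlanderIwaniecAnnals1998, (7.2) (`|δ| ≤ 1`)] -/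
theorem abs_fiDelta_le_fiAbsProd (z₁ z₂ : GaussianInt) : |((fiDelta z₁ z₂ : ℤ) : ℝ)| ≤ fiAbsProd z₁ z₂ := by
  rw [fiDelta_eq_fiAbsProd_mul_sin, abs_mul, abs_of_nonneg (lsk_fiAbsProd_nonneg z₁ z₂)]
  calc fiAbsProd z₁ z₂ * |Real.sin (gaussArg z₂ - gaussArg z₁)| ≤ fiAbsProd z₁ z₂ * 1 :=
        mul_le_mul_of_nonneg_left (Real.abs_sin_le_one _) (lsk_fiAbsProd_nonneg z₁ z₂)
    _ = fiAbsProd z₁ z₂ := mul_one _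

/-- `Δ ≠ 0 ⇒ |z₁z₂| > 0`. [folklore] -/
private theorem lsk_fiAbsProd_pos {z₁ z₂ : GaussianInt} (hΔ : fiDelta z₁ z₂ ≠ 0) : 0 < fiAbsProd z₁ z₂ := by
  have h1 : (0 : ℝ) < |((fiDelta z₁ z₂ : ℤ) : ℝ)| := abs_pos.mpr (by exact_mod_cast hΔ)
  exact lt_of_lt_of_le h1 (abs_fiDelta_le_fiAbsProd z₁ z₂)

/-! ### The logarithm of (10.13) is `L(α₂ - α₁)` -/

/-- **(15.4)/(16.7) in the tree's vocabulary**: `log(2|z₁z₂|/|Δ(z₁,z₂)|) = log 2 - log|sin(arg z₂ - arg z₁)|`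
(`Δ ≠ 0`). [cite: FriedlanderIwaniecAnnals1998, (15.4) and (16.7) with (7.2)] -/
theorem log_fiAbsProd_div_fiDelta {z₁ z₂ : GaussianInt} (hΔ : fiDelta z₁ z₂ ≠ 0) :
    Real.log (2 * fiAbsProd z₁ z₂ / |((fiDelta z₁ z₂ : ℤ) : ℝ)|) = fiLogSin (gaussArg z₂ - gaussArg z₁) := by
  have hΔ' : (conj (GaussianInt.toComplex z₁) * GaussianInt.toComplex z₂).im ≠ 0 := by
    rw [← fiDelta_cast]; exact_mod_cast hΔ
  rw [fiDelta_cast, fiAbsProd_eq_norm_mul, gaussArg, gaussArg]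
  exact log_two_mul_norm_div_abs_im hΔ'

/-- The same with the angle difference taken the other way (`L` is even).
[cite: FriedlanderIwaniecAnnals1998, (15.4) and (16.7) with (7.2)] -/
theorem log_fiAbsProd_div_fiDelta' {z₁ z₂ : GaussianInt} (hΔ : fiDelta z₁ z₂ ≠ 0) :
    Real.log (2 * fiAbsProd z₁ z₂ / |((fiDelta z₁ z₂ : ℤ) : ℝ)|) = fiLogSin (gaussArg z₁ - gaussArg z₂) := by
  rw [log_fiAbsProd_div_fiDelta hΔ, ← fiLogSin_neg, neg_sub]

/-- **The kernel of (10.13) through `L`**: `φ(d)/d · χ_d(z₂/z₁) · log(2|z₁z₂|/|Δ|) = φ(d)/d · χ_d(z₂/z₁) · L(arg z₂ - arg z₁)`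
(`Δ ≠ 0`, which holds for every pair contributing to `T(β)`). [cite: FriedlanderIwaniecAnnals1998, (10.13) with (15.4)] -/
theorem fiTKernel_eq_fiLogSin (d : ℕ) {z₁ z₂ : GaussianInt} (hΔ : fiDelta z₁ z₂ ≠ 0) :
    fiTKernel d z₁ z₂ =
      ((d.totient : ℝ) / d) * (fiChi d z₁ z₂ : ℝ) * fiLogSin (gaussArg z₂ - gaussArg z₁) := by
  rw [fiTKernel, log_fiAbsProd_div_fiDelta hΔ]

/-- The trivial lower size: `log 2 ≤ log(2|z₁z₂|/|Δ|)` (`Δ ≠ 0`). [cite: FriedlanderIwaniecAnnals1998, (15.4) (`-log ½|sin| ≥ log 2`)] -/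
theorem log_two_le_log_kernel {z₁ z₂ : GaussianInt} (hΔ : fiDelta z₁ z₂ ≠ 0) :
    Real.log 2 ≤ Real.log (2 * fiAbsProd z₁ z₂ / |((fiDelta z₁ z₂ : ℤ) : ℝ)|) := by
  rw [log_fiAbsProd_div_fiDelta hΔ]; exact log_two_le_fiLogSin _

/-- The trivial upper size: `log(2|z₁z₂|/|Δ|) ≤ log(2|z₁z₂|)` since `|Δ| ≥ 1` is a nonzero integer.
[cite: FriedlanderIwaniecAnnals1998, §10 after (10.13) ("`1 ≤ |Δ| ≤ N`")] -/
theorem log_kernel_le {z₁ z₂ : GaussianInt} (hΔ : fiDelta z₁ z₂ ≠ 0) :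
    Real.log (2 * fiAbsProd z₁ z₂ / |((fiDelta z₁ z₂ : ℤ) : ℝ)|) ≤ Real.log (2 * fiAbsProd z₁ z₂) := by
  have hA := lsk_fiAbsProd_pos hΔ
  have h1 : (1 : ℝ) ≤ |((fiDelta z₁ z₂ : ℤ) : ℝ)| := by
    rw [← Int.cast_abs]; exact_mod_cast Int.one_le_abs hΔ
  refine Real.log_le_log (by positivity) ?_
  rw [div_le_iff₀ (by positivity)]
  nlinarith

/-! ### The mollified kernel -/

/-- **Off the diagonal the mollifier is invisible** (tree vocabulary): if `|z₁z₂| ≤ H |Δ(z₁,z₂)|` then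
`u_H(arg z₂ - arg z₁) = log(2|z₁z₂|/|Δ|)` (`H > 0`, `Δ ≠ 0`).
[cite: FriedlanderIwaniecAnnals1998, §15 after (15.7); §16 (16.6)–(16.7)] -/
theorem logSineMollifier_gaussArg_sub_eq {H : ℝ} (hH : 0 < H) {z₁ z₂ : GaussianInt} (hΔ : fiDelta z₁ z₂ ≠ 0)
    (hfar : fiAbsProd z₁ z₂ ≤ H * |((fiDelta z₁ z₂ : ℤ) : ℝ)|) :
    logSineMollifier H (gaussArg z₂ - gaussArg z₁) = Real.log (2 * fiAbsProd z₁ z₂ / |((fiDelta z₁ z₂ : ℤ) : ℝ)|) := by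
  have hΔ' : (conj (GaussianInt.toComplex z₁) * GaussianInt.toComplex z₂).im ≠ 0 := by
    rw [← fiDelta_cast]; exact_mod_cast hΔ
  rw [fiDelta_cast, fiAbsProd_eq_norm_mul] at hfar ⊢
  rw [gaussArg, gaussArg]
  exact logSineMollifier_arg_sub_eq hH hΔ' hfar

/-- The same with the angle difference taken the other way (`u_H` is even).
[cite: FriedlanderIwaniecAnnals1998, §15 after (15.7); §16 (16.6)–(16.7)] -/
theorem logSineMollifier_gaussArg_sub_eq' {H : ℝ} (hH : 0 < H) {z₁ z₂ : GaussianInt} (hΔ : fiDelta z₁ z₂ ≠ 0)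
    (hfar : fiAbsProd z₁ z₂ ≤ H * |((fiDelta z₁ z₂ : ℤ) : ℝ)|) :
    logSineMollifier H (gaussArg z₁ - gaussArg z₂) = Real.log (2 * fiAbsProd z₁ z₂ / |((fiDelta z₁ z₂ : ℤ) : ℝ)|) := by
  rw [← logSineMollifier_neg, neg_sub]; exact logSineMollifier_gaussArg_sub_eq hH hΔ hfar

/-- **Pointwise cost of mollifying**: `0 ≤ L(α) - u_H(α) ≤ L(α)` for every `α` (the cutoff takes values in
`[0, 1]` and `L ≥ log 2 > 0`). [cite: FriedlanderIwaniecAnnals1998, (16.6) ("by a trivial estimation we can remove the terms … near the diagonal")] -/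
theorem fiLogSin_sub_logSineMollifier_mem_Icc (H α : ℝ) :
    fiLogSin α - logSineMollifier H α ∈ Set.Icc 0 (fiLogSin α) := by
  obtain ⟨h0, h1⟩ := logSineCutoff_mem_Icc H α
  have hL : 0 ≤ fiLogSin α := (Real.log_pos one_lt_two).le.trans (log_two_le_fiLogSin α)
  unfold logSineMollifier
  constructor <;> nlinarith

/-- **The near-diagonal terms** (tree vocabulary): for every pair with `Δ ≠ 0`,
`|log(2|z₁z₂|/|Δ|) - u_H(arg z₂ - arg z₁)| ≤ [|z₁z₂| > H|Δ|] · log(2|z₁z₂|)` (`H > 0`) — zero off the diagonal,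
trivially bounded on it. [cite: FriedlanderIwaniecAnnals1998, (16.6) (cost `O(d⁻¹H⁻¹N²)` of the terms with `|α₂ - α₁| < 2πH⁻¹`)] -/
theorem abs_log_kernel_sub_mollifier_le {H : ℝ} (hH : 0 < H) {z₁ z₂ : GaussianInt} (hΔ : fiDelta z₁ z₂ ≠ 0) :
    |Real.log (2 * fiAbsProd z₁ z₂ / |((fiDelta z₁ z₂ : ℤ) : ℝ)|) - logSineMollifier H (gaussArg z₂ - gaussArg z₁)| ≤
      if fiAbsProd z₁ z₂ ≤ H * |((fiDelta z₁ z₂ : ℤ) : ℝ)| then 0 else Real.log (2 * fiAbsProd z₁ z₂) := by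
  split_ifs with hfar
  · rw [logSineMollifier_gaussArg_sub_eq hH hΔ hfar, sub_self, abs_zero]
  · rw [log_fiAbsProd_div_fiDelta hΔ]
    obtain ⟨h0, h1⟩ := fiLogSin_sub_logSineMollifier_mem_Icc H (gaussArg z₂ - gaussArg z₁)
    rw [abs_of_nonneg h0]
    exact h1.trans ((log_fiAbsProd_div_fiDelta hΔ).symm.le.trans (log_kernel_le hΔ))

end Literature.NumberTheory.Sieve.FriedlanderIwaniecPrimes
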